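import Summits.Ventures.CertifiedManyBodySolver.Downfold.RouterWordScore

/-!
# The v8 rows M355–M362, the cur-1 g20/g21 drafts, and the morning prints of 2026-08-28: score-2's pre-registered
# router-word readings (PREREG §E 06:3xZ / 07:0xZ / 07:1xZ / 09:0xZ, by reference to Y87) as kernel facts of the §4.2 score

Venture CertifiedManyBodySolver, cell `pub/hubbard-downfold`, seat hubbard-downfold-score-2 (g14); namespace
`Summit.Ventures.CertifiedManyBodySolver.Downfold.RouterScore` (REUSES `score`, `Head`, `Outcome`, `outcome` of
`RouterWordScore.lean`; nothing new is defined). Context: the validation-set tranche v8 (the out-of-sample router-word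
table «MO-PRED-1.k», 149 → 157 materials on 2026-08-28) gained M355 NbRh₂B₂ · M356 TaRh₂B₂ · M357 CoSi₂ · M358 PtGe
(lead R-mk) and M359 MoB₂ · M360 CrB₂-AFM · M361 CrB₂-HP · M362 PdTe (lead R-mq, the CrB₂ row SPLIT per R-mn (b)); the
curator's successor drafts (CaIrSi₃ / CaPtSi₃ / OsB₂ / RuB₂) carry typed expected words too. score-2 registered, BEFORE any
descriptor run or word on these rows, what every plausible print SCORES under ACCEPTANCE §4.2 and PRE-NAMED the at-risk
shape per row (python twin: `validation/score/router/router_score.py` `outcome()`, every case below checked there first).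

* §1 TWO FACTS «BY CONSTRUCTION OF THE TRUTH FILE» that the registrations lean on, as theorems of `score`:
  (i) `typed_straddle_asymmetry` — the SAME print «UND:MIXED+EPH» scores `AGREE` where the curators typed the pair
  «EPH | UND:MIXED+EPH» (M355/M356/M359/M361, CaIrSi₃/CaPtSi₃, OsB₂/RuB₂) and `PARTIAL` where only «EPH» is typed
  (M351 IrGe / M352 RhGe / M358 PtGe) — a difference made by the expected-word set, not by the router or the scorer;
  (ii) `crb2_one_row_trap` — had CrB₂ been ONE row typed with the M163-Cr pair «UND:MULTIORB | UND:MULTIORB+EPH» for all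
  pressures (ruling option (i)), a CORRECT paramagnetic high-pressure print «EPH» or «UND:MIXED+EPH» would score `DISAGREE`
  while the ambient «UND:MULTIORB(+EPH)» print scores `AGREE`; the SPLIT (option (ii), adopted in lead R-mn (b)) scores each
  regime by its own letter (`crb2_split_hp`, `crb2_split_afm`).
* §2 the per-row readings (M355–M362 and the drafts) with their PRE-NAMED at-risk shapes.
* §3 the prints of the morning against their registrations: M297 SrRh₂ / M296 SrIr₂ / M351 IrGe / M352 RhGe «UND:MIXED+EPH» on
  «EPH»-typed rows ⇒ PARTIAL (pre-named R3c straddle); M306 Tl-2223 U-school straddle composite ⇒ PARTIAL (pre-named);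
  M329 LaNiC₂ P-SPLIT print — @0 «UND:MIXED+EPH» ⇒ PARTIAL, @2/@4/@6 «EPH» ⇒ AGREE (so the material is not all-AGREE
  column-wise); the «EPH» AGREEs (Pt₄Ge₁₂ trio, SiC:B, BaBi₃, β-Bi₂Pd, NaBi, Bi₂Te₃ high-P).

WHAT THIS IS NOT: not a word, not a prediction that any material prints these words, not a score of record (v8 rows are
written once at the lead's «v8 CLOSE», never pooled with the calibration R), and not physics. Material names appear only in
docstrings. Words outside the §4.2 token grammar («FM», «AFM») are `ABSTAIN(uncoded)` in the python scorer and outside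
this model (see `RouterWordScore.lean`); descriptor payloads «(k=5; J_H)», «(m_muB[…] straddles …)» are annotations of a
head and do not change its token.
-/

namespace Summit.Ventures.CertifiedManyBodySolver.Downfold

namespace RouterScore

open Head

/-! ## §1 Two facts by construction of the expected-word set -/

/-- (i) The typed-straddle ASYMMETRY: the print «UND:MIXED+EPH» is `AGREE` against «EPH | UND:MIXED+EPH» and `PARTIAL`
against «EPH» alone; the print «EPH» is `AGREE` against both. (M355/M356/M359/M361 and the drafts carry the pair; M351/M352/
M358 carry «EPH» only — registered before their words so the difference is not read as a scorer's choice.) [folklore] -/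
theorem typed_straddle_asymmetry :
    score [undMixed, eph] [[eph], [undMixed, eph]] = .AGREE ∧ score [undMixed, eph] [[eph]] = .PARTIAL
    ∧ score [eph] [[eph], [undMixed, eph]] = .AGREE ∧ score [eph] [[eph]] = .AGREE := by decide

/-- (ii) The ONE-ROW TRAP for CrB₂ (ruling option (i): the M163-Cr pair «UND:MULTIORB | UND:MULTIORB+EPH» typed for ALL
pressures): a correct paramagnetic high-P print «EPH» or «UND:MIXED+EPH» scores `DISAGREE` (neither head typed), while the
ambient ordered-AFM print «UND:MULTIORB(+EPH)» scores `AGREE` — the superconducting columns would be un-agreeable by the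
truth file. [folklore] -/
theorem crb2_one_row_trap :
    score [eph] [[undMultiorb], [undMultiorb, eph]] = .DISAGREE
    ∧ score [undMixed, eph] [[undMultiorb], [undMultiorb, eph]] = .DISAGREE
    ∧ score [undMultiorb] [[undMultiorb], [undMultiorb, eph]] = .AGREE
    ∧ score [undMultiorb, eph] [[undMultiorb], [undMultiorb, eph]] = .AGREE := by decide

/-- … and the SPLIT adopted in lead R-mn (b): the high-pressure row M361 «CrB2-HP» typed «EPH | UND:MIXED+EPH» scores the
same two prints `AGREE`; its PRE-NAMED at-risk shape — the Cr-3d k = 5 head carried up from ambient, «UND:MULTIORB+EPH» —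
is `PARTIAL`, and «UND:MULTIORB» alone `DISAGREE`. [folklore] -/
theorem crb2_split_hp :
    score [eph] [[eph], [undMixed, eph]] = .AGREE ∧ score [undMixed, eph] [[eph], [undMixed, eph]] = .AGREE
    ∧ score [undMultiorb, eph] [[eph], [undMixed, eph]] = .PARTIAL
    ∧ score [undMultiorb] [[eph], [undMixed, eph]] = .DISAGREE := by decide

/-- … the ambient control row M360 «CrB2-AFM» (typed with the M163-Cr pair; control-nonSC): «UND:MULTIORB(+EPH)» `AGREE`;
PRE-NAMED at-risk shapes — a moment composite «UND:MIXED(m…)+UND:MULTIORB+EPH» head ⇒ `PARTIAL`; «EPH» or «UND:MIXED+EPH»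
(the d machinery silent on an ordered 3d magnet) ⇒ `DISAGREE`. An AGREE here is a mechanism word on a non-superconductor,
not an SC call. [folklore] -/
theorem crb2_split_afm :
    score [undMultiorb] [[undMultiorb], [undMultiorb, eph]] = .AGREE
    ∧ score [undMultiorb, eph] [[undMultiorb], [undMultiorb, eph]] = .AGREE
    ∧ score [undMixed, undMultiorb, eph] [[undMultiorb], [undMultiorb, eph]] = .PARTIAL
    ∧ score [eph] [[undMultiorb], [undMultiorb, eph]] = .DISAGREE
    ∧ score [undMixed, eph] [[undMultiorb], [undMultiorb, eph]] = .DISAGREE := by decide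

/-! ## §2 The per-row readings registered before any word (PREREG §E 2026-08-28T06:3xZ … 09:0xZ) -/

/-- M355 NbRh₂B₂ / M356 TaRh₂B₂ (chiral P3₁ 4d/5d ordering pair), M359 MoB₂ (P-axis row), and the drafts CaIrSi₃ / CaPtSi₃ /
OsB₂ / RuB₂ — all typed «EPH | UND:MIXED+EPH»: «EPH(+SA)» and the d-manifold straddle «UND:MIXED+EPH» ⇒ AGREE; PRE-NAMED
at-risk shapes «UND:MULTIORB(k; J_H)+EPH» ⇒ PARTIAL · «UND:STRUCT…» PRIMARY (15-atom P3₁ cell; β-MoB₂ high-P column) ⇒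
ABSTAIN_structure · «UND:MIXED» without EPH ⇒ PARTIAL · «UND:LATTICE+…» primary ⇒ PARTIAL (but EPH-led «EPH+UND:LATTICE» ⇒ AGREE).
[folklore] -/
theorem v8g14_pair_typed :
    score [eph, sa] [[eph], [undMixed, eph]] = .AGREE ∧ score [undMixed, eph] [[eph], [undMixed, eph]] = .AGREE
    ∧ score [undMultiorb, eph] [[eph], [undMixed, eph]] = .PARTIAL
    ∧ score [undStruct, eph] [[eph], [undMixed, eph]] = .ABSTAIN_structure
    ∧ score [undStruct, undMixed, eph] [[eph], [undMixed, eph]] = .ABSTAIN_structure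
    ∧ score [undMixed] [[eph], [undMixed, eph]] = .PARTIAL
    ∧ score [undLattice, eph] [[eph], [undMixed, eph]] = .PARTIAL
    ∧ score [eph, undLattice] [[eph], [undMixed, eph]] = .AGREE := by decide

/-- M357 CoSi₂ (the non-magnetic Co-compound BCS control vs elemental Co M164), typed «EPH | UND:MULTIORB+EPH»; the curator
asked the score pens for a PRE-STATEMENT of the D3 Co-d reading — registered 06:3xZ: «EPH(+SA)» ⇒ AGREE; «UND:MULTIORB(k=5;
J_H)+EPH» ⇒ AGREE (typed: the d-shell head may fire while EPH rides); the NAMED TEST as a score — the elemental-Co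
escalation «UND:MULTIORB» WITHOUT EPH ⇒ PARTIAL; a D10 moment composite or an R3c straddle head «UND:MIXED(…)+…(+EPH)» ⇒
PARTIAL; «UND:MIXED» alone ⇒ DISAGREE; «UND:STRUCT…» primary ⇒ ABSTAIN_structure. (M362 PdTe and the v8 LaNiC₂ row carry the
same typed pair and hence the same table.) [folklore] -/
theorem v8g14_cosi2 :
    score [eph, sa] [[eph], [undMultiorb, eph]] = .AGREE ∧ score [undMultiorb, eph] [[eph], [undMultiorb, eph]] = .AGREE
    ∧ score [undMultiorb] [[eph], [undMultiorb, eph]] = .PARTIAL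
    ∧ score [undMixed, eph] [[eph], [undMultiorb, eph]] = .PARTIAL
    ∧ score [undMixed, undMultiorb, eph] [[eph], [undMultiorb, eph]] = .PARTIAL
    ∧ score [undMixed] [[eph], [undMultiorb, eph]] = .DISAGREE
    ∧ score [undStruct, eph] [[eph], [undMultiorb, eph]] = .ABSTAIN_structure := by decide

/-- M358 PtGe (MnP-type B31 member beside IrGe M351 / RhGe M352), typed «EPH» ONLY: «EPH(+SA)» ⇒ AGREE; PRE-NAMED at-risk
= the Pt-5d R3c straddle «UND:MIXED+EPH» ⇒ PARTIAL (cf. §1 (i)); «UND:MULTIORB(k; J_H)+EPH» ⇒ PARTIAL; «UND:STRUCT…» primary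
⇒ ABSTAIN_structure; «BI» or «UND:MIXED» alone ⇒ DISAGREE. [folklore] -/
theorem v8g14_ptge :
    score [eph, sa] [[eph]] = .AGREE ∧ score [undMixed, eph] [[eph]] = .PARTIAL ∧ score [undMultiorb, eph] [[eph]] = .PARTIAL
    ∧ score [undStruct, eph] [[eph]] = .ABSTAIN_structure ∧ score [bi] [[eph]] = .DISAGREE
    ∧ score [undMixed] [[eph]] = .DISAGREE := by decide

/-! ## §3 The prints of 2026-08-28 06:19–08:35Z against their registrations -/

/-- PRE-NAMED PARTIAL hits on «EPH»-typed rows: M297 SrRh₂ (06:19Z) · M296 SrIr₂ (07:47Z) · M351 IrGe (07:52Z) · M352 RhGe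
(08:3xZ) each printed «UND:MIXED+EPH» = the R3c r_man straddle shape named in the g12/g13 notes ⇒ PARTIAL; IrGe/RhGe printed
IDENTICAL words as registered. [folklore] -/
theorem v8g14_prints_straddle : score [undMixed, eph] [[eph]] = .PARTIAL := by decide

/-- PRE-NAMED PARTIAL hit on a trilayer cuprate: M306 Tl-2223 @0 (06:28Z) «UND:MIXED+1BH+3BE+EPH+UND:MIXED(@Cu-IP)+1BH(@Cu-IP)
+3BE(@Cu-IP)+EPH(@Cu-IP)» vs «1BH+3BE» = the U-school straddle shape (ii) of the g13 'tl2223' note ⇒ PARTIAL; the clean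
trilayer word «1BH+3BE(+EPH)…» would have been AGREE. [folklore] -/
theorem v8g14_print_tl2223 :
    score [undMixed, bh1, be3, eph, undMixed, bh1, be3, eph] [[bh1, be3]] = .PARTIAL
    ∧ score [bh1, be3, eph, bh1, be3, eph] [[bh1, be3]] = .AGREE := by decide

/-- The P-SPLIT print of M329 LaNiC₂ (06:54Z; typed «EPH | UND:MULTIORB+EPH»): @0 «UND:MIXED+EPH» ⇒ PARTIAL (the PRE-NAMED
Ni-3d straddle), @2 / @4 / @6 GPa «EPH» ⇒ AGREE — column-wise 3 AGREE / 1 PARTIAL, hence NOT material-all-AGREE for the R of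
record (the header-vs-all-columns shape of `RouterScoreColumns.lean`). [folklore] -/
theorem v8g14_print_lanic2_psplit :
    score [undMixed, eph] [[eph], [undMultiorb, eph]] = .PARTIAL ∧ score [eph] [[eph], [undMultiorb, eph]] = .AGREE := by
  decide

/-- The registered AGREEs printed: «EPH» on «EPH»-typed rows (M315/M318/M319 {La,Ba,Sr}Pt₄Ge₁₂ · M258 SiC:B · M261 BaBi₃ ×2 ·
M268 β-Bi₂Pd · M312 NaBi · M325 Bi₂Te₃ @2/@4.8) ⇒ AGREE; and the tetradymite @0 «BI» on its «EPH | EPH+UND:STRUCT | BI»-typed column ⇒ AGREE.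
[folklore] -/
theorem v8g14_prints_agree : score [eph] [[eph]] = .AGREE ∧ score [bi] [[eph], [eph, undStruct], [bi]] = .AGREE := by
  decide

end RouterScore

end Summit.Ventures.CertifiedManyBodySolver.Downfold
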